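import Summits.AnomalousDissipation.AnomalousDissipation.Theses.TwoAndHalfD
import Literature.Analysis.FluidPDE.DoeringFoiasPowerProofs
import Literature.Analysis.FluidPDE.DoeringFoiasProofs
import Literature.Analysis.FluidPDE.DoeringFoiasAmplitudeProofs
import Literature.Analysis.FluidPDE.ZerothLawProofs
import Literature.Analysis.FluidPDE.LongTimeAverageNonneg
import Literature.Analysis.FluidPDE.LongTimeAverageSubadditive
import Literature.Analysis.FluidPDE.LerayHopfSpectralMeasurability
import Literature.Analysis.FluidPDE.TwoHalfSection
import Literature.Analysis.FluidPDE.TwoHalfNavierStokes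
import Literature.Analysis.FunctionSpaces.TorusTestFunction
import Literature.Analysis.FunctionSpaces.TorusFourierConvolution
import Literature.Barriers.AnomalousDissipation.TwoDimensionalEnergyDissipationProofs
import Literature.Analysis.FluidPDE.PlanarDescentEnergyEq
import Summits.AnomalousDissipation.AnomalousDissipation.Theorems.TwohalfdThesis.Negative.DescentWeak

/-!
# Negative knowledge for the crux `TwohalfdThesis` (stmt-AnomalousDissipation-0206), III: the planar-force no-go modulo
# ONE named classical gap (2½-D descent with the 2-D energy equality)

Certified copy of §3b (generic part) and §5 of the cdisprove work file `Cruxes/TwohalfdThesis/Disproof.lean` (route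
`TwoAndHalfD`, target `X := TwohalfdThesis`).

* `shapeOf` / `integral_norm_sq_le_of_isGlobalLerayHopf` — a GENERAL smooth solenoidal mean-zero force as a Doering–Foias
  `ForcingShape` (`f = ‖f‖₂ · Φ(1 • x)`), so that the tree's `ForcingShape`-theorems (amplitude bound, Alexakis–Doering)
  apply to arbitrary steady forces; the amplitude bound `‖f‖₂² ≤ C⟨‖u‖²⟩ + νK⟨‖u‖²⟩^{1/2}` in that generality, and the
  ENERGY FLOOR `‖f‖₂² ≤ ‖∇f‖_∞ · E` (`integral_norm_sq_le_mul_of_family`) for every bounded-energy Leray–Hopf family under a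
  fixed steady force as `ν_j → 0` (witness or not).
* `Literature.Analysis.FluidPDE.PlanarDescentEnergyEq` (named fact, relocated from this file) — THE GAP, one textbook statement not yet PROVED in the tree: the planar part of an `x₃`-invariant global
  Leray–Hopf solution driven by `(g,h)∘π` is a 2-D global Leray–Hopf solution driven by `g` and obeys the long-time energy
  budget `⟨g,v⟩ ≤ ⟨ν‖∇v‖²⟩` (Bardos–Lopes Filho–Niu–Nussenzveig Lopes–Titi 2013 §2; Lions–Prodi / FMRT 2001 Ch. II Thm 7.3).
* `not_twohalfdThesisPlanarForceSmoothData_of_descent : PlanarDescentEnergyEq → ¬ TwohalfdThesisPlanarForceSmoothData` —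
  PROVED: no witness of `X` with a planar force `(g,0)∘π` and smooth data (Doering–Foias power inequality
  `DoeringFoias2002_dissipation_le_power_holds`, `meanPower_twoHalf_zero`, `meanEnergy_planarPart_le`, and the tree's proved
  2-D no-zeroth-law `Literature.Barriers.AnomalousDissipation.no_twoDimensional_zerothLaw`).  Reading: the third component of a
  witness MUST be sourced; all the anomaly is scalar dissipation paid for by `⟨h, u₃⟩`.
The parts `planarPart`/`verticalPart` and their first lemmas are those of `Negative/DescentWeak.lean` (namespace `…Negative.Descent`,
imported), whose `Descent.isWeakNSSolutionForcedOn_planarPart` and `Negative/DescentScalar.lean` prove the bookkeeping half of the gap.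
Supports stmt-AnomalousDissipation-0206 (negative lemma modulo `PlanarDescentEnergyEq`).
-/

noncomputable section

namespace Summit.AnomalousDissipation.AnomalousDissipation.Theorems.TwohalfdThesis.Negative

open MeasureTheory Set Filter Topology UnitAddTorus
open scoped ENNReal NNReal InnerProductSpace
open Literature.Analysis.FunctionSpaces Literature.Analysis.FunctionSpaces.Torus
open Literature.Analysis.FluidPDE Literature.Analysis.FluidPDE.Torus
open Summit.AnomalousDissipation.AnomalousDissipation.Theorems.TwohalfdThesis.Negative.Descent

/-- Local notation: the flat unit three-torus. -/
local notation "𝕋³" => UnitAddTorus (Fin 3)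
/-- Local notation: velocity values. -/
local notation "E³" => EuclideanSpace ℝ (Fin 3)

/-! ## §3b Energy floor: a fixed force pins the energy of ANY bounded-energy family from below -/

section EnergyFloor

variable {d : Type*} [Fintype d] [DecidableEq d]

/-- `div (c • g) = c · div g` on the torus, with no differentiability hypothesis (`deriv_const_mul_field`). [folklore] -/
theorem divergence_const_smul (c : ℝ) (g : UnitAddTorus d → EuclideanSpace ℝ d) (x : UnitAddTorus d) :
    Torus.divergence (c • g) x = c * Torus.divergence g x := by
  unfold Torus.divergence Torus.partialDeriv Torus.lineDeriv
  rw [Finset.mul_sum]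
  refine Finset.sum_congr rfl fun i _ => ?_
  simp only [Pi.smul_apply, PiLp.smul_apply, smul_eq_mul]
  exact deriv_const_mul_field c

/-- The `L²`-normalised shape `f/‖f‖₂` of a nonzero smooth solenoidal mean-zero field, as a Doering–Foias
`ForcingShape` (so that the tree's amplitude / Alexakis–Doering bounds apply to a GENERAL steady force:
`f = ‖f‖₂ · Φ(1 • x)`). [folklore] -/
def shapeOf (f : UnitAddTorus d → EuclideanSpace ℝ d) (hs : IsSmooth f) (hd : IsDivFree f) (hz : HasZeroMean f)
    (hA : 0 < ∫ x, ‖f x‖ ^ 2) : ForcingShape d where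
  shape := (Real.sqrt (∫ x, ‖f x‖ ^ 2))⁻¹ • f
  smooth := hs.smul _
  divFree := fun x => by rw [divergence_const_smul, hd x, mul_zero]
  zeroMean := by
    show ∫ x, ((Real.sqrt (∫ x, ‖f x‖ ^ 2))⁻¹ • f) x = 0
    simp_rw [Pi.smul_apply, integral_smul]
    rw [show (∫ x, f x) = 0 from hz, smul_zero]
  sq_norm_eq_one := by
    have hA' : 0 < Real.sqrt (∫ x, ‖f x‖ ^ 2) := Real.sqrt_pos.2 hA
    simp_rw [Pi.smul_apply, norm_smul, mul_pow, integral_const_mul, Real.norm_eq_abs, abs_inv, abs_of_pos hA',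
      inv_pow, Real.sq_sqrt hA.le]
    exact inv_mul_cancel₀ hA.ne'

variable {f : UnitAddTorus d → EuclideanSpace ℝ d} {hs : IsSmooth f} {hd : IsDivFree f} {hz : HasZeroMean f}
  {hA : 0 < ∫ x, ‖f x‖ ^ 2}

/-- The unit-amplitude force of `shapeOf f` is `f/‖f‖₂`. [folklore] -/
theorem shapeOf_force_one_one : (shapeOf f hs hd hz hA).force 1 1 = (Real.sqrt (∫ x, ‖f x‖ ^ 2))⁻¹ • f := by
  funext x
  simp [ForcingShape.force, shapeOf]

/-- The force of `shapeOf f` at amplitude `‖f‖₂` is `f` itself. [folklore] -/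
theorem shapeOf_force_one_norm : (shapeOf f hs hd hz hA).force 1 (Real.sqrt (∫ x, ‖f x‖ ^ 2)) = f := by
  funext x
  simp only [ForcingShape.force, shapeOf, one_smul, Pi.smul_apply, smul_smul]
  rw [mul_inv_cancel₀ (Real.sqrt_pos.2 hA).ne', one_smul]

omit hs hd hz hA in
/-- **Doering–Foias amplitude bound for a GENERAL steady smooth force** (Cheskidov–Doering–Petrov eq. (18) tested against the
force itself; in tree for `ForcingShape` forces: `DoeringFoias.abs_amplitude_le_of_isGlobalLerayHopf`): for every global
Leray–Hopf solution `u` of NS_ν on `T^d` driven by `f`,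
`‖f‖₂² ≤ C ⟨‖u‖²⟩ + ν K ⟨‖u‖²⟩^{1/2}` whenever `∑ᵢ‖∂ᵢf‖ ≤ C` and `‖Δf‖ ≤ K` pointwise. [cite: CheskidovDoeringPetrov2006, §III eq. (18)] -/
theorem integral_norm_sq_le_of_isGlobalLerayHopf {ν' : ℝ} (hν : 0 < ν') (hs : IsSmooth f) (hd : IsDivFree f)
    (hz : HasZeroMean f) {v₀ : UnitAddTorus d → EuclideanSpace ℝ d} {v : ℝ → UnitAddTorus d → EuclideanSpace ℝ d}
    (hu : IsGlobalLerayHopf ν' (fun _ => f) v₀ v)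
    {C K : ℝ} (hC : 0 ≤ C) (hK : 0 ≤ K) (hCf : ∀ x, ∑ i, ‖Torus.partialDeriv i f x‖ ≤ C)
    (hKf : ∀ x, ‖Torus.laplacian f x‖ ≤ K) :
    ∫ x, ‖f x‖ ^ 2 ≤ C * meanEnergy v + ν' * K * Real.sqrt (meanEnergy v) := by
  have hE0 : 0 ≤ meanEnergy v := meanEnergy_nonneg v
  by_cases hA : ∫ x, ‖f x‖ ^ 2 = 0
  · rw [hA]; positivity
  have hApos : 0 < ∫ x, ‖f x‖ ^ 2 := lt_of_le_of_ne (integral_nonneg fun _ => sq_nonneg _) (Ne.symm hA)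
  set A : ℝ := Real.sqrt (∫ x, ‖f x‖ ^ 2) with hAdef
  have hA0 : 0 < A := Real.sqrt_pos.2 hApos
  set Φ : ForcingShape d := shapeOf f hs hd hz hApos with hΦ
  have hu' : IsGlobalLerayHopf ν' (fun _ => Φ.force 1 A) v₀ v := by
    rw [show (fun _ : ℝ => Φ.force 1 A) = fun _ => f from funext fun _ => shapeOf_force_one_norm]
    exact hu
  have hf1 : Φ.force 1 1 = A⁻¹ • f := shapeOf_force_one_one
  have hC' : ∀ x, ∑ i, ‖Torus.partialDeriv i (Φ.force 1 1) x‖ ≤ C / A := by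
    intro x
    rw [hf1]
    have : ∀ i, ‖Torus.partialDeriv i (A⁻¹ • f) x‖ = A⁻¹ * ‖Torus.partialDeriv i f x‖ := fun i => by
      rw [partialDeriv_const_smul (hs.isContDiff (by simp)) A⁻¹ i, Pi.smul_apply, norm_smul, Real.norm_eq_abs,
        abs_of_pos (inv_pos.2 hA0)]
    simp_rw [this, ← Finset.mul_sum]
    rw [div_eq_inv_mul]
    exact mul_le_mul_of_nonneg_left (hCf x) (inv_pos.2 hA0).le
  have hK' : ∀ x, ‖Torus.laplacian (Φ.force 1 1) x‖ ≤ K / A := by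
    intro x
    rw [hf1, laplacian_const_smul_apply hs, norm_smul, Real.norm_eq_abs, abs_of_pos (inv_pos.2 hA0), div_eq_inv_mul]
    exact mul_le_mul_of_nonneg_left (hKf x) (inv_pos.2 hA0).le
  have h := DoeringFoias.abs_amplitude_le_of_isGlobalLerayHopf hν one_pos hu' (div_nonneg hC hA0.le) (div_nonneg hK hA0.le)
    hC' hK'
  rw [abs_of_pos hA0, rmsVelocity_eq_sqrt_meanEnergy, Real.sq_sqrt hE0] at h
  have h2 := mul_le_mul_of_nonneg_left h hA0.le
  have hAA : A * A = ∫ x, ‖f x‖ ^ 2 := by rw [hAdef, ← sq, Real.sq_sqrt hApos.le]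
  calc ∫ x, ‖f x‖ ^ 2 = A * A := hAA.symm
    _ ≤ A * (C / A * meanEnergy v + ν' * (K / A) * Real.sqrt (meanEnergy v)) := h2
    _ = C * meanEnergy v + ν' * K * Real.sqrt (meanEnergy v) := by field_simp

omit hs hd hz hA in
/-- **ENERGY FLOOR `‖f‖₂² ≤ ‖∇f‖_∞ · E` for EVERY bounded-energy Leray–Hopf family under a fixed steady force as `ν_j → 0`**
(precisely `∫‖f‖² ≤ C·E` for every pointwise bound `∑ᵢ‖∂ᵢf‖ ≤ C`): the amplitude bound at every level,
`‖f‖₂² ≤ C E + ν_j K √E`, pushed to `j → ∞`.  No dissipation hypothesis: witness or not, the energy ceiling of a family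
driven by `f` can never be below the force's own scale `‖f‖₂²/‖∇f‖_∞`. [cite: CheskidovDoeringPetrov2006, §III eq. (18)] -/
theorem integral_norm_sq_le_mul_of_family (hs : IsSmooth f) (hd : IsDivFree f) (hz : HasZeroMean f)
    {ν : ℕ → ℝ} (hν : ∀ j, 0 < ν j) (hν0 : Tendsto ν atTop (𝓝 0))
    {v₀ : ℕ → UnitAddTorus d → EuclideanSpace ℝ d} {v : ℕ → ℝ → UnitAddTorus d → EuclideanSpace ℝ d}
    (hu : ∀ j, IsGlobalLerayHopf (ν j) (fun _ => f) (v₀ j) (v j)) {E : ℝ} (hE : ∀ j, meanEnergy (v j) ≤ E)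
    {C : ℝ} (hC : 0 ≤ C) (hCf : ∀ x, ∑ i, ‖Torus.partialDeriv i f x‖ ≤ C) :
    ∫ x, ‖f x‖ ^ 2 ≤ C * E := by
  obtain ⟨K, hK, hKf⟩ := exists_nonneg_forall_norm_le_of_continuous (hs.laplacian).continuous
  have hj : ∀ j, ∫ x, ‖f x‖ ^ 2 ≤ C * E + ν j * K * Real.sqrt E := fun j => by
    have h1 := integral_norm_sq_le_of_isGlobalLerayHopf (hν j) hs hd hz (hu j) hC hK hCf hKf
    have hm : meanEnergy (v j) ≤ E := hE j
    have hm0 : 0 ≤ meanEnergy (v j) := meanEnergy_nonneg _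
    have hνK : 0 ≤ ν j * K := mul_nonneg (hν j).le hK
    nlinarith [mul_le_mul_of_nonneg_left hm hC, mul_le_mul_of_nonneg_left (Real.sqrt_le_sqrt hm) hνK]
  have ht : Tendsto (fun j => C * E + ν j * K * Real.sqrt E) atTop (𝓝 (C * E + 0 * K * Real.sqrt E)) :=
    tendsto_const_nhds.add ((hν0.mul_const K).mul_const _)
  rw [zero_mul, zero_mul, add_zero] at ht
  exact ge_of_tendsto' ht hj

end EnergyFloor

/-! ## §5 The planar-force no-go, reduced to ONE classical gap (2½-D descent with the 2-D energy equality) -/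

section PlanarDescent

/-- Local notation: the flat two-torus. -/
local notation "𝕋²" => UnitAddTorus (Fin 2)
/-- Local notation: planar velocity values. -/
local notation "E²" => EuclideanSpace ℝ (Fin 2)

variable {U : 𝕋³ → E³}

/-- The planar energy is dominated by the total energy: `∫‖v‖² ≤ ∫‖U‖²`. [folklore] -/
theorem integral_norm_sq_planarPart_le (hU : ∀ (s : UnitAddCircle) (x : 𝕋³), U (x + Pi.single (2 : Fin 3) s) = U x)
    (h2 : MemLp U 2 volume) : ∫ y, ‖planarPart U y‖ ^ 2 ≤ ∫ x, ‖U x‖ ^ 2 := by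
  obtain ⟨hV, hR⟩ := memLp_parts hU h2
  conv_rhs => rw [eq_twoHalf_parts hU, integral_norm_sq_twoHalf_of_memLp hV hR]
  have : 0 ≤ ∫ y, verticalPart U y ^ 2 := integral_nonneg fun _ => sq_nonneg _
  linarith

/-- **A planar force only works on the planar part**: `∫⟪(g,0)∘π, U⟫ = ∫⟪g, v⟫`. [folklore] -/
theorem integral_inner_twoHalf_zero_left {g : 𝕋² → E²} (hg : MemLp g 2 volume)
    (hU : ∀ (s : UnitAddCircle) (x : 𝕋³), U (x + Pi.single (2 : Fin 3) s) = U x) (h2 : MemLp U 2 volume) :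
    ∫ x, ⟪twoHalf g 0 x, U x⟫_ℝ = ∫ y, ⟪g y, planarPart U y⟫_ℝ := by
  obtain ⟨hV, -⟩ := memLp_parts hU h2
  conv_lhs => rw [eq_twoHalf_parts hU]
  have hc : ∀ x, ⟪twoHalf g 0 x, twoHalf (planarPart U) (verticalPart U) x⟫_ℝ =
      ⟪twoHalf (planarPart U) (verticalPart U) x, twoHalf g 0 x⟫_ℝ := fun x => real_inner_comm _ _
  simp_rw [hc, integral_inner_twoHalf_planar hV hg]
  exact integral_congr_ae (ae_of_all _ fun y => real_inner_comm _ _)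

/-- Long-time averages only see the observable on `(0, ∞)`. [folklore] -/
theorem longTimeAvgSup_congr_Ioi {a b : ℝ → ℝ} (h : ∀ t, 0 < t → a t = b t) : longTimeAvgSup a = longTimeAvgSup b := by
  unfold longTimeAvgSup
  refine limsup_congr ?_
  filter_upwards [eventually_gt_atTop (0 : ℝ)] with T hT
  unfold timeMean
  rw [intervalIntegral.integral_of_le hT.le, intervalIntegral.integral_of_le hT.le,
    setIntegral_congr_fun measurableSet_Ioc fun t ht => h t ht.1]

variable {u : ℝ → 𝕋³ → E³}

/-- **The mean power of a planar force is the planar mean power**: `⟨(g,0)∘π, u⟩ = ⟨g, v⟩` for an `x₃`-invariant flow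
with `L²` slices at positive times. [folklore] -/
theorem meanPower_twoHalf_zero {g : 𝕋² → E²} (hg : MemLp g 2 volume)
    (hinv : ∀ (t : ℝ) (s : UnitAddCircle) (x : 𝕋³), u t (x + Pi.single (2 : Fin 3) s) = u t x)
    (h2 : ∀ t, 0 < t → MemLp (u t) 2 volume) :
    meanPower (twoHalf g 0) u = meanPower g (fun t => planarPart (u t)) :=
  longTimeAvgSup_congr_Ioi fun t ht => integral_inner_twoHalf_zero_left hg (hinv t) (h2 t ht)

/-- **The planar mean energy is dominated by the total mean energy** (honest `limsup`s: the running means of the energy of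
a Leray–Hopf solution under a steady smooth mean-zero force are bounded, `Torus.IsGlobalLerayHopf.timeMean_norm_sq_le`). [folklore] -/
theorem meanEnergy_planarPart_le {ν' : ℝ} (hν : 0 < ν') {F : 𝕋³ → E³} (hF : IsSmooth F) (hF0 : HasZeroMean F)
    {u₀ : 𝕋³ → E³} (hu : IsGlobalLerayHopf ν' (fun _ => F) u₀ u)
    (hinv : ∀ (t : ℝ) (s : UnitAddCircle) (x : 𝕋³), u t (x + Pi.single (2 : Fin 3) s) = u t x) :
    meanEnergy (fun t => planarPart (u t)) ≤ meanEnergy u := by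
  rw [meanEnergy_eq_longTimeAvgSup, meanEnergy_eq_longTimeAvgSup]
  refine longTimeAvgSup_mono (fun t => integral_nonneg fun _ => sq_nonneg _)
    (fun t => integral_nonneg fun _ => sq_nonneg _) (fun T hT => hu.integrableOn_integral_norm_sq hT)
    (fun t ht => integral_norm_sq_planarPart_le (hinv t) ((hu (t + 1) (by linarith)).memLp t ⟨ht.le, by linarith⟩)) ?_
  exact isBoundedUnder_of_eventually_le (eventually_atTop.2 ⟨1, fun T hT => hu.timeMean_norm_sq_le hν hF hF0 hT⟩)

-- The gap `PlanarDescentEnergyEq` is the named fact `Literature.Analysis.FluidPDE.PlanarDescentEnergyEq`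
-- (relocated by the gate from this file, p85621; see its docstring for the statement, the paper proof and the sources).

/-- `X` restricted to PLANAR forces `f = (g,0)∘π` and SMOOTH `x₃`-invariant data (the natural sub-case a constructor would try
first: the third component is an unforced passive scalar). -/
def TwohalfdThesisPlanarForceSmoothData : Prop :=
  ∃ g : 𝕋² → E², IsSmooth g ∧ IsDivFree g ∧ HasZeroMean g ∧
    ∃ (ν : ℕ → ℝ) (u₀ : ℕ → 𝕋³ → E³) (u : ℕ → ℝ → 𝕋³ → E³),
      (∀ j, 0 < ν j) ∧ Tendsto ν atTop (𝓝 0) ∧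
      (∀ j, IsSmooth (u₀ j)) ∧ (∀ j (s : UnitAddCircle) (x : 𝕋³), u₀ j (x + Pi.single (2 : Fin 3) s) = u₀ j x) ∧
      (∀ j, IsGlobalLerayHopf (ν j) (fun _ => twoHalf g 0) (u₀ j) (u j)) ∧
      (∀ j (t : ℝ) (s : UnitAddCircle) (x : 𝕋³), u j t (x + Pi.single (2 : Fin 3) s) = u j t x) ∧
      (∃ E : ℝ, ∀ j, meanEnergy (u j) ≤ E) ∧
      ∃ ε : ℝ, 0 < ε ∧ ∀ j, ε ≤ meanDissipation (ν j) (u j)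

/-- **PLANAR-FORCE NO-GO MODULO THE DESCENT GAP.**  Given `PlanarDescentEnergyEq`, `X` has no witness with a planar force and
smooth data: `ε ≤ ⟨ν_j‖∇u_j‖²⟩ ≤ ⟨f,u_j⟩` (Doering–Foias, tree) `= ⟨g,v_j⟩` (`meanPower_twoHalf_zero`) `≤ ⟨ν_j‖∇v_j‖²⟩` (the
gap), while the 2-D Leray–Hopf family `v_j` has mean energy `≤ E` (`meanEnergy_planarPart_le`), smooth data, and
`U_j > 0` (else `⟨g,v_j⟩ ≤ ‖g‖U_j = 0 < ε`), so Alexakis–Doering (`Literature.Barriers.AnomalousDissipation.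
no_twoDimensional_zerothLaw`, PROVED in tree; `g = ‖g‖₂·Φ` via `shapeOf`) gives `⟨ν_j‖∇v_j‖²⟩ → 0` — contradiction.  So the
third component MUST be sourced (`h ≠ 0`): all the anomaly of a witness is scalar dissipation paid for by `⟨h, u₃⟩`. [folklore] -/
theorem not_twohalfdThesisPlanarForceSmoothData_of_descent (H : PlanarDescentEnergyEq) :
    ¬ TwohalfdThesisPlanarForceSmoothData := by
  rintro ⟨g, hgs, hgd, hgz, ν, u₀, u, hν, hν0, hu₀s, hu₀inv, hLH, huinv, ⟨E, hE⟩, ε, hε, hεj⟩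
  have h0s : IsSmooth (fun _ : 𝕋² => (0 : ℝ)) := isSmooth_const _
  have hfs : IsSmooth (twoHalf g 0) := hgs.twoHalf h0s
  have hfz : HasZeroMean (twoHalf g 0) :=
    hasZeroMean_twoHalf hgs.integrable (integrable_const _) hgz (by simp [HasZeroMean])
  set v : ℕ → ℝ → 𝕋² → E² := fun j t => planarPart (u j t) with hv
  have hdesc : ∀ j, IsGlobalLerayHopf (ν j) (fun _ => g) (planarPart (u₀ j)) (v j) ∧
      meanPower g (v j) ≤ meanDissipation (ν j) (v j) :=
    fun j => H (ν j) g 0 (u₀ j) (u j) (hν j) hgs hgd hgz h0s (hLH j) (hu₀inv j) (huinv j)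
  -- ε ≤ ⟨g, v_j⟩ ≤ D₂(v_j)
  have hP : ∀ j, ε ≤ meanPower g (v j) := fun j => by
    have h1 := DoeringFoias2002_dissipation_le_power_holds (hν j) (hfs.memLp 2) hfz (u₀ j) (u j) (hLH j)
    have h2 : meanPower (twoHalf g 0) (u j) = meanPower g (v j) :=
      meanPower_twoHalf_zero (hgs.memLp 2) (huinv j) fun t ht => ((hLH j) (t + 1) (by linarith)).memLp t ⟨ht.le, by linarith⟩
    exact (hεj j).trans (h1.trans h2.le)
  have hD : ∀ j, ε ≤ meanDissipation (ν j) (v j) := fun j => (hP j).trans (hdesc j).2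
  -- power ceiling for the 2-D solution: ε ≤ ‖g‖₂ U_j
  have hPU : ∀ j, ε ≤ Real.sqrt (∫ y, ‖g y‖ ^ 2) * rmsVelocity longTimeAvgSup (v j) := fun j =>
    (hP j).trans (Torus.IsGlobalLerayHopf.meanPower_le (hν j) hgs hgz (hdesc j).1)
  have hg0 : 0 < ∫ y, ‖g y‖ ^ 2 := by
    by_contra h0
    have h0' : ∫ y, ‖g y‖ ^ 2 = 0 := le_antisymm (not_lt.1 h0) (integral_nonneg fun _ => sq_nonneg _)
    have := hPU 0
    rw [h0', Real.sqrt_zero, zero_mul] at this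
    exact absurd this (not_le.2 hε)
  have hUpos : ∀ j, 0 < rmsVelocity longTimeAvgSup (v j) := fun j => by
    by_contra hU
    have hU0 : rmsVelocity longTimeAvgSup (v j) = 0 := le_antisymm (not_lt.1 hU) (Real.sqrt_nonneg _)
    have := hPU j
    rw [hU0, mul_zero] at this
    exact absurd this (not_le.2 hε)
  have hUle : ∀ j, rmsVelocity longTimeAvgSup (v j) ≤ Real.sqrt E := fun j => by
    rw [rmsVelocity_eq_sqrt_meanEnergy]
    exact Real.sqrt_le_sqrt ((meanEnergy_planarPart_le (hν j) hfs hfz (hLH j) (huinv j)).trans (hE j))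
  -- Alexakis–Doering for the 2-D family `v_j` driven by `g = ‖g‖₂ · Φ(1 • x)`
  set Φ : ForcingShape (Fin 2) := shapeOf g hgs hgd hgz hg0 with hΦ
  have hforce : (fun _ : ℝ => Φ.force 1 (Real.sqrt (∫ y, ‖g y‖ ^ 2))) = fun _ => g :=
    funext fun _ => shapeOf_force_one_norm
  have hLH2 : ∀ j, IsGlobalLerayHopf (ν j) (fun _ => Φ.force 1 (Real.sqrt (∫ y, ‖g y‖ ^ 2)))
      (planarPart (u₀ j)) (v j) := fun j => by
    rw [hforce]; exact (hdesc j).1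
  have hsm : ∀ j, IsSmooth (planarPart (u₀ j)) := fun j => by
    have h := hu₀s j
    rw [eq_twoHalf_parts (hu₀inv j)] at h
    exact isSmooth_left_of_twoHalf h
  have hT := Literature.Barriers.AnomalousDissipation.no_twoDimensional_zerothLaw Φ one_pos
    (Real.sqrt (∫ y, ‖g y‖ ^ 2)) ν hν hν0 (fun j => planarPart (u₀ j)) v hsm hLH2 (Ubar := Real.sqrt E)
    (fun j => ⟨hUpos j, hUle j⟩)
  obtain ⟨j, hj⟩ := (hT.eventually (gt_mem_nhds hε)).exists
  exact (not_lt.2 (hD j)) hj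

end PlanarDescent

end Summit.AnomalousDissipation.AnomalousDissipation.Theorems.TwohalfdThesis.Negative

end
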